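/-
Copyright (c) 2026 the pub-hodgecm-mathlib formalisation cell (harness21).  Prover seat hodgecm-mathlib-R90-C10-p07 (g2) acting for R90-TF section S8 «ContSpec-n½»
(dealer R90-CS-plan (g2), successor brief of record S8-R95, memo `R90/S8/CENSUS-IwasawaInertU3.R90-C10-p07-g0.md`): the EXPLICIT Iwasawa factorisation of
`ι(w₀) · u(X, Z)` on the big cell of `U(2,1)` — ring-generic, then at an inert place of a CM field (FILE 1 of 2; the torus-entry letter (α) of ★ `K2E1ChiLocalWeightShellU3` in the
S8 chain's base coordinates is the sequel `K2E1BigCellIwasawaTorusEntryU3Letters`).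
-/
import Literature.NumberTheory.Automorphic.HeisenbergChartAtNonsplitPlace                -- ★ `valued_conjLocal_apply_of_smul_eq`; brings ★ `CMPrincipalSeriesSpherical` (`mem_cmLocalIntegralLevel_iff_forall_v_le_one`)
import Literature.NumberTheory.QuadraticForms.HermitianUnimodularRankThreeRamified       -- ★ `antidiagonal_three_over` (`Φ₃` as an explicit matrix over any commutative ring)
import Summits.HodgeConjecture.HodgeConjecture.Theorems.K2E1IntertwiningLocalMeanCMU3     -- ★ `placesOver_good`; brings ★ `K2E1IntertwiningLocalFactorU3Height` (`valued_corner_eq_max`, `valued_quadraticLocalEquiv_apply_eq_max`), ★ `normAbs_le_normAbs_iff_valued`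
import HarnessLib

/-!
# K2·E1 ∕ R90·S8 — `K2E1BigCellIwasawaTorusEntryU3`: THE EXPLICIT IWASAWA FACTORISATION OF `w₀ · u(x, z)` ON THE BIG CELL OF `U(2,1)` (ring-generic; inert CM place)

Cell `pub/hodgecm-mathlib`, crux h413 = `stmt-HodgeConjecture-24833`, route of record `HCCMUnconditional`; R90-TF section S8 «ContSpec-n½» (the (NV) road of socket #3:
★ (a-1) `K2E1ChiIntertwiningScalarEulerProductU3Finite` ← ★ B1-local `K2E1ChiIntertwiningLocalScalarU3` ← ★ (W) `K2E1ChiLocalWeightShellU3` ← THIS FILE).  THEOREMS ONLY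
(no `def`, no `instance`, no notation, no named-fact hypothesis, no `sorry`; default heartbeats); lane `--supports stmt-HodgeConjecture-24833 --as helper` (count-neutral).

THE MATHEMATICS ([Rogawski1990] §1.10 p. 9, §4.5 p. 45; [MoeglinWaldspurger1995] I.2.2, II.1.6; [Casselman1980] §3).  In `U(σ, Φ₃)(R)` (`Φ₃ = antidiag(1,1,1)`, `σ` an
involution of the commutative ring `R`) let `u = u(x, z) = (1 x z; 0 1 −σx; 0 0 1)` with `z + σz + xσx = 0`, and let `z`, `σz` be units.  Then (§1, RING-GENERIC, EXPLICIT)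
  `Φ₃ · u(x, z) = b · k`,  `b = (σz⁻¹  x z⁻¹  1; 0  σz·z⁻¹  −σx; 0 0 z)` UPPER TRIANGULAR with diagonal `(σ(z)⁻¹, σ(z)∕z, z)`,  `k = (1 0 0; σx·σz⁻¹  −1  0; z⁻¹  x z⁻¹  1)`,
  `k⁻¹ = (1 0 0; σx·σz⁻¹  −1  0; σz⁻¹  x z⁻¹  1)`, all three in `U(σ, Φ₃)(R)` (`exists_borel_mul_eq_weylLong_mul_heis`).
At a finite place `v` of `L⁺` NON-SPLIT in the CM field `L` (`w` the place above it, `R = L ⊗ L⁺_v`, `σ = c ⊗ 1`) the entries of `k`, `k⁻¹` are `w`-integral as soon as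
`|z|_w ≥ 1` and `|x|_w ≤ |z|_w` (§2): **`w₀ · u(x,z) = b · k` with `b ∈ B(L⁺_v)` and `k ∈ K_v = U(Φ₃)(𝒪_v)`**, FIRST TORUS ENTRY `σ(z)⁻¹` (`exists_borel_mul_integral_eq_weylLong_mul_of_nonsplit`; `w₀` = ANY element of matrix `Φ₃`);
this IS the Iwasawa decomposition of the big cell (pivot = the corner entry `z`, `|σ z|_w = |z|_w`); the torus part is read through ★ `cmBorelTriple … .proj` (`coe_torusEntry_proj_eq_of_val_eq`).
The SEQUEL `K2E1BigCellIwasawaTorusEntryU3Letters` reads it in the base coordinates `p = (a, b, t)` of the S8 chain (`X = Ψ_v(a,b)`, `Z = ι t·δ − ½ X σX`, height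
`Q_v(p) = ∏_{w'∣v} max(1, ‖X_{w'}‖, ‖Z_{w'}‖)`): off the unit shell `Q_v(p) = ‖Z_w‖` (`‖X_w‖² ≤ ‖Z_w‖`), so `α(p) = σ(Z)_w⁻¹` satisfies `‖α(p)‖_w · Q_v(p) = 1` — the letter (α)
`hα` of ★ `K2E1ChiLocalWeightShellU3.shell_nonsplit_of_torusEntry` — and `w₀ · u(X, Z) ∈ B · (α-torus) · K_v` (resp. `∈ K_v` on the unit shell), which turns the weight of a
`χ`-spherical section into `χ_w(α(p))` (letter (c), the consumer's definition of `ω`).  Also here (§1): `u(x,z) ∈ U ⟸ z + σz + xσx = 0` (`heis_mem_of_rel`), `u(x,z)⁻¹`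
(`heis_inv_val`), `Φ₃⁻¹ = Φ₃` (`antidiag_inv_val`) — the chart-free matrix facts the sequel needs.
HONEST LABEL: HC_CM is proved only modulo the 7 printed citations (2 remaining named inputs: hLiu418 = `stmt-HodgeConjecture-24832`, h413 = `stmt-HodgeConjecture-24833`) until rung 0
closes; this file asserts no named fact and closes no socket; count-neutral; unconditional matrix algebra and local valuation bookkeeping.

## References
* [Rogawski1990] J. D. Rogawski, *Automorphic Representations of Unitary Groups in Three Variables*, Ann. of Math. Stud. 123 (1990), §1.10 p. 9, §4.5 p. 45.
* [MoeglinWaldspurger1995] C. Mœglin, J.-L. Waldspurger, *Spectral Decomposition and Eisenstein Series* (1995), I.2.2, II.1.6.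
* [Casselman1980] W. Casselman, *The unramified principal series of p-adic groups I*, Compositio Math. 40 (1980), §3.
-/

set_option autoImplicit false
set_option linter.dupNamespace false -- the mandated namespace repeats `HodgeConjecture.HodgeConjecture`

noncomputable section

open NumberField IsDedekindDomain
open scoped NNReal Matrix
open Literature.NumberTheory.Automorphic Literature.NumberTheory.Automorphic.UnitaryGroup

namespace Summit.HodgeConjecture.HodgeConjecture.Cruxes.H413.K2E1BigCellIwasawaTorusEntryU3

/-! ## §1 Ring-generic: the explicit big-cell identity `Φ₃ · u(x,z) = b · k` in `U(σ, Φ₃)(R)` -/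

section RingGeneric

variable {R : Type*} [CommRing R] (σ : R →+* R)

/-- For an involution `σ`: the inverse `zi` of `z` and the inverse `zbi` of `σ z` are exchanged by `σ` (`σ zi = zbi`, `σ zbi = zi`). [folklore] -/
theorem map_inv_of_involutive (hσ : ∀ a, σ (σ a) = a) {z zi zbi : R} (hzi : z * zi = 1) (hzbi : σ z * zbi = 1) :
    σ zi = zbi ∧ σ zbi = zi := by
  have h1 : σ z * σ zi = 1 := by rw [← map_mul, hzi, map_one]
  have h2 : z * σ zbi = 1 := by
    have := congrArg σ hzbi
    rwa [map_mul, hσ, map_one] at this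
  constructor
  · calc σ zi = σ zi * (σ z * zbi) := by rw [hzbi, mul_one]
      _ = zbi := by rw [← mul_assoc, mul_comm (σ zi), h1, one_mul]
  · calc σ zbi = σ zbi * (z * zi) := by rw [hzi, mul_one]
      _ = zi := by rw [← mul_assoc, mul_comm (σ zbi), h2, one_mul]

/-- **THE BIG-CELL IDENTITY IN `U(2,1)`, ring-generic and explicit** (matrices): for `z + σz + xσx = 0` with `z zi = 1`, `σz · zbi = 1`,
`Φ₃ · (1 x z; 0 1 −σx; 0 0 1) = (zbi  x·zi  1; 0  σz·zi  −σx; 0 0 z) · (1 0 0; σx·zbi  −1  0; zi  x·zi  1)`. [cite: MoeglinWaldspurger1995, I.2.2] [cite: Rogawski1990, §1.10 p. 9] -/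
theorem antidiag_mul_heis_eq {x z zi zbi : R} (hzi : z * zi = 1) (hzbi : σ z * zbi = 1) (hrel : z + σ z + x * σ x = 0) :
    (!![(0 : R), 0, 1; 0, 1, 0; 1, 0, 0] : Matrix (Fin 3) (Fin 3) R) * !![1, x, z; 0, 1, -σ x; 0, 0, 1] =
      !![zbi, x * zi, 1; 0, σ z * zi, -σ x; 0, 0, z] * !![1, 0, 0; σ x * zbi, -1, 0; zi, x * zi, 1] := by
  ext i j
  fin_cases i <;> fin_cases j <;>
    simp [Matrix.mul_apply, Fin.sum_univ_three, Matrix.cons_val_zero, Matrix.cons_val_one]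
  · linear_combination (-(zi * zbi)) * hrel + zbi * hzi + zi * hzbi
  · linear_combination (-(σ x * zi)) * hzbi
  · linear_combination zi * hrel - hzi
  · linear_combination -hzi
  · linear_combination (-x) * hzi

/-- `k · k⁻¹ = 1` for the explicit compact factor `k = (1 0 0; σx·zbi −1 0; zi x·zi 1)`, `k⁻¹ = (1 0 0; σx·zbi −1 0; zbi x·zi 1)`. [folklore] -/
theorem lowerK_mul_lowerKInv {x z zi zbi : R} (hzi : z * zi = 1) (hzbi : σ z * zbi = 1) (hrel : z + σ z + x * σ x = 0) :
    (!![1, 0, 0; σ x * zbi, -1, 0; zi, x * zi, 1] : Matrix (Fin 3) (Fin 3) R) * !![1, 0, 0; σ x * zbi, -1, 0; zbi, x * zi, 1] = 1 := by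
  ext i j
  fin_cases i <;> fin_cases j <;>
    simp [Matrix.mul_apply, Fin.sum_univ_three, Matrix.cons_val_zero, Matrix.cons_val_one]
  linear_combination (zi * zbi) * hrel + (-zbi) * hzi + (-zi) * hzbi

/-- `k⁻¹ · k = 1`. [folklore] -/
theorem lowerKInv_mul_lowerK {x z zi zbi : R} (hzi : z * zi = 1) (hzbi : σ z * zbi = 1) (hrel : z + σ z + x * σ x = 0) :
    (!![1, 0, 0; σ x * zbi, -1, 0; zbi, x * zi, 1] : Matrix (Fin 3) (Fin 3) R) * !![1, 0, 0; σ x * zbi, -1, 0; zi, x * zi, 1] = 1 := by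
  ext i j
  fin_cases i <;> fin_cases j <;>
    simp [Matrix.mul_apply, Fin.sum_univ_three, Matrix.cons_val_zero, Matrix.cons_val_one]
  linear_combination (zi * zbi) * hrel + (-zbi) * hzi + (-zi) * hzbi

/-- **`k ∈ U(σ, Φ₃)(R)`** for the explicit compact factor (`σ` an involution; the unitarity sums reduce to `σ zi = zbi`, `σ zbi = zi` and the Heisenberg relation).
[cite: Rogawski1990, §1.10 p. 9] -/
theorem lowerK_mem (hσ : ∀ a, σ (σ a) = a) {x z zi zbi : R} (hzi : z * zi = 1) (hzbi : σ z * zbi = 1) (hrel : z + σ z + x * σ x = 0)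
    {k : GL (Fin 3) R} (hk : (k : Matrix (Fin 3) (Fin 3) R) = !![1, 0, 0; σ x * zbi, -1, 0; zi, x * zi, 1]) :
    k ∈ unitaryGroupOfForm σ ((StdForm.antidiagonal 3).over R) := by
  obtain ⟨h1, h2⟩ := map_inv_of_involutive σ hσ hzi hzbi
  rw [mem_unitaryGroupOfForm_antidiagonal_iff_sum']
  have r0 : (0 : Fin 3).rev = 2 := rfl; have r1 : (1 : Fin 3).rev = 1 := rfl; have r2 : (2 : Fin 3).rev = 0 := rfl
  intro a b
  fin_cases a <;> fin_cases b <;>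
    simp [hk, Fin.sum_univ_three, r0, r1, r2, hσ, map_neg, map_one, map_zero, h1, h2, Matrix.cons_val_zero, Matrix.cons_val_one]
  · linear_combination (zi * zbi) * hrel + (-zbi) * hzi + (-zi) * hzbi

/-- The Heisenberg relation `z + σz + xσx = 0` HOLDS for every `n ∈ U(σ, Φ₃)(R)` of the shape `u(x, z) = (1 x z; 0 1 −σx; 0 0 1)` (the `(2,2)` unitarity sum; `σ` an involution).
[cite: Rogawski1990, §1.10 p. 9] -/
theorem heis_rel_of_mem (hσ : ∀ a, σ (σ a) = a) {x z : R} {n : GL (Fin 3) R} (hn : (n : Matrix (Fin 3) (Fin 3) R) = !![1, x, z; 0, 1, -σ x; 0, 0, 1])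
    (hnU : n ∈ unitaryGroupOfForm σ ((StdForm.antidiagonal 3).over R)) : z + σ z + x * σ x = 0 := by
  rw [mem_unitaryGroupOfForm_antidiagonal_iff_sum'] at hnU
  have h := hnU 2 2
  have r0 : (0 : Fin 3).rev = 2 := rfl; have r1 : (1 : Fin 3).rev = 1 := rfl; have r2 : (2 : Fin 3).rev = 0 := rfl
  simp [hn, Fin.sum_univ_three, r0, r1, r2, hσ, map_neg, map_one, Matrix.cons_val_zero, Matrix.cons_val_one] at h
  linear_combination h

/-- Conversely, **`u(x, z) ∈ U(σ, Φ₃)(R)` as soon as `z + σz + xσx = 0`** (`σ` an involution): the nine unitarity sums of ★ `mem_unitaryGroupOfForm_antidiagonal_iff_sum'`.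
[cite: Rogawski1990, §1.10 p. 9] -/
theorem heis_mem_of_rel (hσ : ∀ a, σ (σ a) = a) {x z : R} (hrel : z + σ z + x * σ x = 0) {n : GL (Fin 3) R}
    (hn : (n : Matrix (Fin 3) (Fin 3) R) = !![1, x, z; 0, 1, -σ x; 0, 0, 1]) : n ∈ unitaryGroupOfForm σ ((StdForm.antidiagonal 3).over R) := by
  rw [mem_unitaryGroupOfForm_antidiagonal_iff_sum']
  have r0 : (0 : Fin 3).rev = 2 := rfl; have r1 : (1 : Fin 3).rev = 1 := rfl; have r2 : (2 : Fin 3).rev = 0 := rfl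
  intro a b
  fin_cases a <;> fin_cases b <;> simp [hn, Fin.sum_univ_three, r0, r1, r2, hσ, map_neg, map_one, map_zero, Matrix.cons_val_zero, Matrix.cons_val_one]
  · linear_combination hrel

/-- **`u(x, z)⁻¹ = (1  −x  σz; 0  1  σx; 0 0 1)`** for `z + σz + xσx = 0` (the matrix of the inverse of any invertible `n` of shape `u(x, z)`; ★ `HeisRing.heisMatrixInv`). [cite: Rogawski1990, §1.10 p. 9] -/
theorem heis_inv_val {x z : R} (hrel : z + σ z + x * σ x = 0) {n : GL (Fin 3) R} (hn : (n : Matrix (Fin 3) (Fin 3) R) = !![1, x, z; 0, 1, -σ x; 0, 0, 1]) :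
    ((n⁻¹ : GL (Fin 3) R) : Matrix (Fin 3) (Fin 3) R) = !![1, -x, σ z; 0, 1, σ x; 0, 0, 1] := by
  refine Units.inv_eq_of_mul_eq_one_right ?_
  rw [hn]
  ext i j
  fin_cases i <;> fin_cases j <;> simp [Matrix.mul_apply, Fin.sum_univ_three, Matrix.cons_val_zero, Matrix.cons_val_one]
  linear_combination hrel

/-- `Φ₃⁻¹ = Φ₃` (the matrix of the inverse of any invertible `w` of matrix `Φ₃`; `Φ₃² = 1`). [cite: Rogawski1990, §1.10 p. 9] -/
theorem antidiag_inv_val {w : GL (Fin 3) R} (hw : (w : Matrix (Fin 3) (Fin 3) R) = !![(0 : R), 0, 1; 0, 1, 0; 1, 0, 0]) :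
    ((w⁻¹ : GL (Fin 3) R) : Matrix (Fin 3) (Fin 3) R) = !![(0 : R), 0, 1; 0, 1, 0; 1, 0, 0] := by
  refine Units.inv_eq_of_mul_eq_one_right ?_
  rw [hw]
  ext i j
  fin_cases i <;> fin_cases j <;> simp [Matrix.mul_apply, Fin.sum_univ_three, Matrix.cons_val_zero, Matrix.cons_val_one]

/-- **THE IWASAWA FACTORISATION OF `Φ₃ · u(x, z)` ON THE BIG CELL OF `U(σ, Φ₃)(R)`, ring-generic and explicit.**  `σ` an involution, `n ∈ U(σ, Φ₃)(R)` of shape `u(x, z)`,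
`z zi = 1`, `σz · zbi = 1`, `w` of matrix `Φ₃`.  Then `w · n = b · k` with `b, k ∈ U(σ, Φ₃)(R)`, `b = (zbi  x·zi  1; 0  σz·zi  −σx; 0 0 z)` UPPER TRIANGULAR (diagonal `(σz⁻¹, σz∕z, z)`:
FIRST TORUS ENTRY `σ(z)⁻¹`), `k = (1 0 0; σx·zbi  −1  0; zi  x·zi  1)`, `k⁻¹ = (1 0 0; σx·zbi  −1  0; zbi  x·zi  1)`.  Over a local field with `|z| ≥ max(1, |x|)` the factor `k` is
integral: this is the Iwasawa decomposition (§2). [cite: MoeglinWaldspurger1995, I.2.2] [cite: Rogawski1990, §1.10 p. 9; §4.5 p. 45] -/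
theorem exists_borel_mul_eq_weylLong_mul_heis (hσ : ∀ a, σ (σ a) = a) {x z zi zbi : R} (hzi : z * zi = 1) (hzbi : σ z * zbi = 1)
    {w n : GL (Fin 3) R} (hw : (w : Matrix (Fin 3) (Fin 3) R) = !![(0 : R), 0, 1; 0, 1, 0; 1, 0, 0])
    (hn : (n : Matrix (Fin 3) (Fin 3) R) = !![1, x, z; 0, 1, -σ x; 0, 0, 1]) (hnU : n ∈ unitaryGroupOfForm σ ((StdForm.antidiagonal 3).over R)) :
    ∃ b k : GL (Fin 3) R,
      (b : Matrix (Fin 3) (Fin 3) R) = !![zbi, x * zi, 1; 0, σ z * zi, -σ x; 0, 0, z] ∧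
      (k : Matrix (Fin 3) (Fin 3) R) = !![1, 0, 0; σ x * zbi, -1, 0; zi, x * zi, 1] ∧
      ((k⁻¹ : GL (Fin 3) R) : Matrix (Fin 3) (Fin 3) R) = !![1, 0, 0; σ x * zbi, -1, 0; zbi, x * zi, 1] ∧
      b ∈ unitaryGroupOfForm σ ((StdForm.antidiagonal 3).over R) ∧ k ∈ unitaryGroupOfForm σ ((StdForm.antidiagonal 3).over R) ∧
      w * n = b * k := by
  have hrel := heis_rel_of_mem σ hσ hn hnU
  let k : GL (Fin 3) R := ⟨_, _, lowerK_mul_lowerKInv σ hzi hzbi hrel, lowerKInv_mul_lowerK σ hzi hzbi hrel⟩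
  have hkU : k ∈ unitaryGroupOfForm σ ((StdForm.antidiagonal 3).over R) := lowerK_mem σ hσ hzi hzbi hrel (k := k) rfl
  have hwU : w ∈ unitaryGroupOfForm σ ((StdForm.antidiagonal 3).over R) := by
    rw [mem_unitaryGroupOfForm_iff, hw, Literature.NumberTheory.QuadraticForms.HermitianUnimodularRamified.antidiagonal_three_over]
    ext i j
    fin_cases i <;> fin_cases j <;> simp [Matrix.mul_apply, Fin.sum_univ_three, Matrix.map_apply]
  refine ⟨w * n * k⁻¹, k, ?_, rfl, rfl, Subgroup.mul_mem _ (Subgroup.mul_mem _ hwU hnU) (Subgroup.inv_mem _ hkU), hkU, by rw [inv_mul_cancel_right]⟩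
  -- the matrix of `b = w n k⁻¹`: `(b k) k⁻¹` with `w n = b k` the explicit identity
  rw [Units.val_mul, Units.val_mul, hw, hn, antidiag_mul_heis_eq σ hzi hzbi hrel, Matrix.mul_assoc,
    show ((!![1, 0, 0; σ x * zbi, -1, 0; zi, x * zi, 1] : Matrix (Fin 3) (Fin 3) R) * ((k⁻¹ : GL (Fin 3) R) : Matrix (Fin 3) (Fin 3) R)) = 1 from
      lowerK_mul_lowerKInv σ hzi hzbi hrel, Matrix.mul_one]

end RingGeneric

/-! ## §2 The CM instance at a NON-SPLIT place: `w₀ · u(x, z) = b · k` with `b ∈ B(L⁺_v)`, `k ∈ K_v = U(Φ₃)(𝒪_v)`, first torus entry `σ(z)⁻¹` -/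

section CM

variable (L : Type) [Field L] [NumberField L] [IsCMField L] (v : HeightOneSpectrum (𝓞 ↥(maximalRealSubfield L))) (w : PlacesOver L v)

include w in
/-- A unit criterion in `R = ∏_{w' ∣ v} L_{w'}` at a NON-SPLIT `v` (one place above `v`): `z · z⁻¹ = 1` as soon as `z_w ≠ 0`. [folklore] -/
theorem mul_inv_eq_one_of_apply_ne_zero (hw : IsCMField.complexConj L • w.1 = w.1) {z : LocalRing L v} (hz : z w ≠ 0) : z * z⁻¹ = 1 := by
  haveI : Algebra.IsQuadraticExtension ↥(maximalRealSubfield L) L := IsCMField.isQuadraticExtension L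
  haveI : Subsingleton (PlacesOver L v) := PlacesOver.subsingleton_of_smul_eq (IsCMField.complexConj L) (IsCMField.complexConj_ne_one L) w hw
  funext w'
  obtain rfl : w' = w := Subsingleton.elim _ _
  rw [Pi.mul_apply, Pi.inv_apply, mul_inv_cancel₀ hz, Pi.one_apply]

/-- **THE IWASAWA DECOMPOSITION OF `ι(w₀) · u(x, z)` AT A NON-SPLIT PLACE — explicit.**  `v` a finite place of `L⁺` non-split in `L` (`w ∣ v`, `c • w = w`), `w₀ ∈ U(Φ₃)(L⁺_v)` the element
of matrix `Φ₃` (any term: ★ `weylLongU`, the local image of the global `ι(w₀)`, the `w₀` of ★ `U3LocalBruhatDecomposition` — it is determined by its matrix), `n = u(x, z) ∈ U(Φ₃)(L⁺_v)`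
with `|z|_w ≥ 1` and `|x|_w ≤ |z|_w` (the OFF-SHELL regime `‖X_w‖² ≤ ‖Z_w‖` of §3).  Then `w₀ · n = b · k` with `b ∈ B(L⁺_v)` of matrix `(σz⁻¹  x z⁻¹  1; 0  σz·z⁻¹  −σx; 0 0 z)` —
FIRST TORUS ENTRY `σ(z)⁻¹`, of absolute value `‖z_w‖⁻¹` — and `k ∈ K_v = U(Φ₃)(𝒪_v)` (the entries `σx∕σz`, `z⁻¹`, `x∕z`, `σz⁻¹` of `k`, `k⁻¹` are `w`-integral; `|σ y|_w = |y|_w`).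
[cite: Rogawski1990, §1.10 p. 9; §4.5 p. 45] [cite: MoeglinWaldspurger1995, I.2.2, II.1.6] [cite: Casselman1980, §3] -/
theorem exists_borel_mul_integral_eq_weylLong_mul_of_nonsplit (hw : IsCMField.complexConj L • w.1 = w.1) {x z : LocalRing L v}
    {w₀ n : ↥(unitaryGroupOfForm (conjLocal L (IsCMField.complexConj L) v) (cmLocalForm L 3 v))}
    (hw₀ : (w₀ : GL (Fin 3) (LocalRing L v)).val = !![(0 : LocalRing L v), 0, 1; 0, 1, 0; 1, 0, 0])
    (hn : (n : GL (Fin 3) (LocalRing L v)).val = !![1, x, z; 0, 1, -conjLocal L (IsCMField.complexConj L) v x; 0, 0, 1])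
    (hz : 1 ≤ Valued.v (z w)) (hxz : Valued.v (x w) ≤ Valued.v (z w)) :
    ∃ b k : ↥(unitaryGroupOfForm (conjLocal L (IsCMField.complexConj L) v) (cmLocalForm L 3 v)),
      b ∈ borelU (conjLocal L (IsCMField.complexConj L) v) (cmLocalForm L 3 v) ∧
      k ∈ cmLocalIntegralLevel L 3 (Matrix.of fun i j : Fin 3 => if i.val + j.val + 1 = 3 then (1 : L) else 0) v ∧
      w₀ * n = b * k ∧
      (b : GL (Fin 3) (LocalRing L v)).val =
        !![(conjLocal L (IsCMField.complexConj L) v z)⁻¹, x * z⁻¹, 1; 0, conjLocal L (IsCMField.complexConj L) v z * z⁻¹, -conjLocal L (IsCMField.complexConj L) v x; 0, 0, z] := by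
  haveI : Algebra.IsQuadraticExtension ↥(maximalRealSubfield L) L := IsCMField.isQuadraticExtension L
  haveI : Subsingleton (PlacesOver L v) := PlacesOver.subsingleton_of_smul_eq (IsCMField.complexConj L) (IsCMField.complexConj_ne_one L) w hw
  have hσ := conjLocal_conjLocal_cm L v
  have hv : ∀ y : LocalRing L v, Valued.v (conjLocal L (IsCMField.complexConj L) v y w) = Valued.v (y w) := valued_conjLocal_apply_of_smul_eq L v w hw
  have hz0' : Valued.v (z w) ≠ 0 := ne_of_gt (lt_of_lt_of_le zero_lt_one hz)
  have hz0 : z w ≠ 0 := fun h => hz0' (by rw [h, Valuation.map_zero])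
  have hσz0 : conjLocal L (IsCMField.complexConj L) v z w ≠ 0 := fun h => hz0' (by rw [← hv z, h, Valuation.map_zero])
  have hzi : z * z⁻¹ = 1 := mul_inv_eq_one_of_apply_ne_zero L v w hw hz0
  have hzbi : conjLocal L (IsCMField.complexConj L) v z * (conjLocal L (IsCMField.complexConj L) v z)⁻¹ = 1 := mul_inv_eq_one_of_apply_ne_zero L v w hw hσz0
  have hnU : (n : GL (Fin 3) (LocalRing L v)) ∈ unitaryGroupOfForm (conjLocal L (IsCMField.complexConj L) v) ((StdForm.antidiagonal 3).over (LocalRing L v)) := by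
    rw [← cmLocalForm_eq_over]; exact n.2
  obtain ⟨b, k, hb, hk, hki, hbU, hkU, hwn⟩ := exists_borel_mul_eq_weylLong_mul_heis (conjLocal L (IsCMField.complexConj L) v) hσ hzi hzbi hw₀ hn hnU
  rw [← cmLocalForm_eq_over] at hbU hkU
  refine ⟨⟨b, hbU⟩, ⟨k, hkU⟩, ?_, ?_, Subtype.ext hwn, hb⟩
  · -- `b` is upper triangular
    rw [mem_borelU_iff]
    intro i j hij
    change (b : GL (Fin 3) (LocalRing L v)).val i j = 0
    rw [hb]
    fin_cases i <;> fin_cases j <;> simp at hij ⊢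
  · -- `k ∈ K_v`: all entries of `k` and `k⁻¹` are `w`-integral
    have hkinv : (((⟨k, hkU⟩ : ↥(unitaryGroupOfForm (conjLocal L (IsCMField.complexConj L) v) (cmLocalForm L 3 v)))⁻¹ :
        ↥(unitaryGroupOfForm (conjLocal L (IsCMField.complexConj L) v) (cmLocalForm L 3 v))) : GL (Fin 3) (LocalRing L v)).val =
        !![1, 0, 0; conjLocal L (IsCMField.complexConj L) v x * (conjLocal L (IsCMField.complexConj L) v z)⁻¹, -1, 0; (conjLocal L (IsCMField.complexConj L) v z)⁻¹, x * z⁻¹, 1] := by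
      rw [Subgroup.coe_inv]; exact hki
    have hxz' : Valued.v (x w) * (Valued.v (z w))⁻¹ ≤ 1 := mul_inv_le_one_of_le₀ hxz zero_le
    have hzi' : (Valued.v (z w))⁻¹ ≤ 1 := inv_le_one_of_one_le₀ hz
    refine (mem_cmLocalIntegralLevel_iff_forall_v_le_one L 3 v _).2 ⟨fun i j w' => ?_, fun i j w' => ?_⟩
    · rw [Subsingleton.elim w' w]
      change Valued.v ((k : GL (Fin 3) (LocalRing L v)).val i j w) ≤ 1
      rw [hk]
      fin_cases i <;> fin_cases j <;> simp [-conjLocal_apply, hv, hxz', hzi']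
    · rw [Subsingleton.elim w' w, hkinv]
      fin_cases i <;> fin_cases j <;> simp [-conjLocal_apply, hv, hxz', hzi']

/-- **THE TORUS PART READ THROUGH THE BOREL TRIPLE**: for the `b` of `exists_borel_mul_integral_eq_weylLong_mul_of_nonsplit` (indeed for any `b ∈ B(L⁺_v)` with `b₀₀ = σ(z)⁻¹`), the first
coordinate of `proj b ∈ T(L⁺_v)` — the argument of `χ₁` in `χ = (χ₁, χ₂)` (★ `torusCharPair`, `i = 0`) — is `σ(z)⁻¹` (★ `coe_torusEntry_proj_borelTriple`). [cite: Rogawski1990, §1.10 p. 9; §12.1 p. 171] -/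
theorem coe_torusEntry_proj_eq_of_val_eq {b : ↥(unitaryGroupOfForm (conjLocal L (IsCMField.complexConj L) v) (cmLocalForm L 3 v))}
    (hbB : b ∈ borelU (conjLocal L (IsCMField.complexConj L) v) (cmLocalForm L 3 v)) {b₀₀ : LocalRing L v}
    (hb : (b : GL (Fin 3) (LocalRing L v)).val 0 0 = b₀₀) :
    ((torusEntry (conjLocal L (IsCMField.complexConj L) v) (cmLocalForm L 3 v) 0 ((cmBorelTriple L 3 v).proj ⟨b, hbB⟩) : (LocalRing L v)ˣ) : LocalRing L v) = b₀₀ := by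
  rw [coe_torusEntry_proj_borelTriple]
  exact hb

end CM

end Summit.HodgeConjecture.HodgeConjecture.Cruxes.H413.K2E1BigCellIwasawaTorusEntryU3

end
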